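import Mathlib
import HarnessLib
import Literature.MathematicalPhysics.QuantumLattice.GrassmannCovarianceResponseTwoLeg
import Literature.MathematicalPhysics.QuantumLattice.HubbardSectorPropagatorGram
import Summits.HubbardSuperconductivity.HubbardSuperconductivity.Theorems.KLProgrammeKLRegimeTwoPointAssemblyConservation
import Summits.HubbardSuperconductivity.HubbardSuperconductivity.Theorems.KLProgrammeKLRegimeWickBubbleChannels

/-!
# K3 ENGINE child (stmt-HubbardSuperconductivity-20236 `KLRegimeEngineV16`), stub `stub_twoLeg_scale0`, clause (E3c-TD)₀:
# the COVARIANCE RESPONSE of the two-leg kernel AT THE READING POINT, between two normal covariances, by Polchinski interpolation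
# — tree term = product (no mass of `Ċ`), loop term = entry sum of `Ċ` × a four-leg sup

Cell gate-hubbard-kl, seat p2 (g10); the cure of the (D2) finding (HOME/p2-g10/TWOLEG-SCALE0-DOORS-p2g10.md, evidence #10 on 20236):
the (E3c)₀ frame response of the scale-`0` two-leg output must NOT be read through the pinned `ℓ¹` MASS of a two-frame difference
element (`…TwoLegMomentsFromGrid.abs_scaleZero_response_le_of_grid`: on the frame class the mass of the reducible chain
`tadpole·δC̃·tadpole` is `≍ 4^N·frameDist`).  In the K-RESUMMED representation of k3c5-p1 g7 ((ρ2): `σ_n − K = Σ^{res}_n` on the tube,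
`Σ^{res}` = self-energy of `effAction C̃^K V_U` with a NORMAL covariance `C̃^K = normalCovariance s_K` and the PURELY QUARTIC `V_U`) the
response between two frames is the response of `𝒲[s] := effAction (normalCovariance s) V_U` to the symbol `s`.  Along the straight path
`s_t = s₀ + t(s₁ − s₀)` (`C_t = C₀ + t(C₁ − C₀)`, `Ċ = normalCovariance (s₁ − s₀)`), Salmhofer's RGE read at the string
`X_q = (ψ̂⁺_q, ψ̂⁻_q)` (`q = (k, σ)`) gives (`Literature/…/GrassmannCovarianceResponseTwoLeg`):

* §1 `normalCovariance` bookkeeping (pairing map `A ↦ Ā = (A.1, 1 − A.2)`, entry sum `Σ_A |Ċ(A,Ā)| = 2Σ_p |ṡ p|`, linearity in the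
  symbol, invariance under vertex-compatible charge scalings);
* §2 **selection rules** for `𝒲[s]`: its two-leg kernel vanishes unless the two labels carry the same `(frequency, momentum, spin)` and
  opposite charges (`covResp_kernel_two_eq_zero_of_fst_ne`, `…_of_charge_eq`) — `U(1)`/translation/spin scalings
  (`…TwoPointAssemblyConservation` machinery on `effAction (normalCovariance s) V_U`); antisymmetry `𝒲₂(Y,X) = −𝒲₂(X,Y)` is p1's `KLRegimeWick.kernel_two_swap01`;
* §3 **the tree term is a product**: `kernel (δ𝒲/δψ, Ċ δ𝒲/δψ) 2 X_q = 4·ṡ(q)·𝒲₂(X_q)²` (`covResp_kernel_two_pairing_eq`);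
* §4 **the loop term**: `‖kernel (Δ_Ċ 𝒲) 2 X_q‖ ≤ 12·(Σ_p ‖ṡ p‖)·N` for `N ≥ ‖𝒲₄(X_q, Ā, A)‖` (`covResp_norm_kernel_two_laplacian_le`);
* §5 **the response inequality** (`covResp_norm_kernel_two_sub_le`): with `Z_t ≠ 0`, `‖𝒲_{t,4}(X_q,Ā,A)‖ ≤ N`, `‖𝒲_{t,2}(X_q)‖ ≤ S` on `[0,1]`,
  `‖𝒲[s₁]₂(X_q) − 𝒲[s₀]₂(X_q)‖ ≤ 12·(Σ_p‖(s₁−s₀) p‖)·N + 2·‖(s₁−s₀) q‖·S²`, and the same ×`2|β|L²` for `selfEnergy`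
  (`covResp_norm_selfEnergy_sub_le`).

For the engine: `s_i` = the resummed UV symbols of the frames `K, K′` (equal OFF the cutoff shell, where `u = 1` and `D = −iω + ξ` is
K-free), so `Σ_p ‖(s₁ − s₀) p‖` is a SHELL sum `≤ |shell|·C_shell·βL²·frameDist` and `‖(s₁−s₀) q‖ ≤ C_shell·βL²·frameDist` pointwise
(`= 0` at reading points inside the zero set of `u`); `N` is an (E1)₀-type four-leg sup along the path (Gram form of a convex combination),
`S` the two-leg sup.  No position moment, no mass of `Ċ`.  Everything is proved; no definitions; nothing about the model's sizes is asserted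
(they enter as hypotheses `hZ`, `hN`, `hS`).  References: Salmhofer 1998 §3.1 Prop. 1, §4.1 [cite: Salmhofer1998]; BGM 2006 §2.1 [cite: BenfattoGiulianiMastropietro2006].
-/

noncomputable section

namespace Summit.HubbardSuperconductivity.HubbardSuperconductivity.Theorems.EngineV8

set_option linter.dupNamespace false -- summit = problem name (single-conjunct summit), D-0017

open Finset Literature.MathematicalPhysics.QuantumLattice Literature.Probability.LatticeModels GrassmannAlgebra
open Summit.HubbardSuperconductivity.HubbardSuperconductivity.Theorems.TwoPointAssembly

variable {L M : ℕ} [NeZero L]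

/-! ## §1 Normal covariances: pairing map, entry sum, linearity, scaling invariance -/

omit [NeZero L] in
/-- A normal covariance pairs `A` only with `Ā = (A.1, 1 − A.2)`. -/
theorem normalCovariance_eq_zero_of_ne_bar (s : FreqMomentum L M × Fin 2 → ℂ) (A B : HubbardFieldIdx L M)
    (h : B ≠ (A.1, 1 - A.2)) : normalCovariance L M s A B = 0 := by
  rw [normalCovariance_apply]
  by_cases h1 : A.1 = B.1
  · rw [if_pos h1]
    obtain ⟨p, c⟩ := A
    obtain ⟨p', c'⟩ := B
    simp only at h1 h
    subst h1
    have hc : ¬(c = 0 ∧ c' = 1) ∧ ¬(c = 1 ∧ c' = 0) := by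
      constructor <;> rintro ⟨rfl, rfl⟩ <;> exact h rfl
    rw [if_neg hc.1, if_neg hc.2]
  · rw [if_neg h1]

omit [NeZero L] in
/-- The paired entries: `C((p,0),(p,1)) = s p`, `C((p,1),(p,0)) = −s p`. -/
theorem normalCovariance_bar (s : FreqMomentum L M × Fin 2 → ℂ) (p : FreqMomentum L M × Fin 2) :
    normalCovariance L M s (p, 0) (p, 1) = s p ∧ normalCovariance L M s (p, 1) (p, 0) = -s p := by
  simp [normalCovariance_apply]

/-- **Entry sum over the pairing map**: `Σ_A ‖C(A, Ā)‖ = 2·Σ_p ‖s p‖`. -/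
theorem sum_norm_normalCovariance_bar (s : FreqMomentum L M × Fin 2 → ℂ) :
    ∑ A : HubbardFieldIdx L M, ‖normalCovariance L M s A (A.1, 1 - A.2)‖ = 2 * ∑ p, ‖s p‖ := by
  rw [Fintype.sum_prod_type, mul_sum]
  refine sum_congr rfl fun p _ => ?_
  rw [Fin.sum_univ_two]
  simp only [Fin.isValue, sub_zero, sub_self, (normalCovariance_bar s p).1, (normalCovariance_bar s p).2, norm_neg]
  ring

omit [NeZero L] in
/-- Linearity of `normalCovariance` in the symbol: the straight path. -/
theorem normalCovariance_linePath (s₀ s₁ : FreqMomentum L M × Fin 2 → ℂ) (t : ℂ) :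
    normalCovariance L M s₀ + t • (normalCovariance L M s₁ - normalCovariance L M s₀) =
      normalCovariance L M (fun p => s₀ p + t * (s₁ p - s₀ p)) := by
  ext A B
  simp only [Matrix.add_apply, Matrix.smul_apply, Matrix.sub_apply, smul_eq_mul, normalCovariance_apply]
  split_ifs <;> ring

omit [NeZero L] in
/-- Linearity: the difference. -/
theorem normalCovariance_sub (s₀ s₁ : FreqMomentum L M × Fin 2 → ℂ) :
    normalCovariance L M s₁ - normalCovariance L M s₀ = normalCovariance L M (fun p => s₁ p - s₀ p) := by
  ext A B
  simp only [Matrix.sub_apply, normalCovariance_apply]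
  split_ifs <;> ring

omit [NeZero L] in
/-- A normal covariance is invariant under every charge scaling `ψ̂⁺_p ↦ φ(p)ψ̂⁺_p`, `ψ̂⁻_p ↦ φ(p)⁻¹ψ̂⁻_p` (it pairs only reciprocal labels). -/
theorem scalingWeight_normalCovariance_invariant (φ : FreqMomentum L M × Fin 2 → ℂ) (hφ : ∀ p, φ p ≠ 0)
    (s : FreqMomentum L M × Fin 2 → ℂ) (X Y : HubbardFieldIdx L M) :
    scalingWeight φ X * scalingWeight φ Y * normalCovariance L M s X Y = normalCovariance L M s X Y := by
  by_cases h : Y = (X.1, 1 - X.2)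
  · subst h
    obtain ⟨p, c⟩ := X
    have hw : scalingWeight φ ((p, c) : HubbardFieldIdx L M) * scalingWeight φ ((p, 1 - c) : HubbardFieldIdx L M) = 1 := by
      fin_cases c <;> simp [scalingWeight, hφ p]
    rw [hw, one_mul]
  · rw [normalCovariance_eq_zero_of_ne_bar s X Y h, mul_zero]

/-! ## §2 The quartic interaction, the resummed effective action `𝒲[s] = effAction (normalCovariance s) V_U`, selection rules -/

/-- The Hubbard vertex is even. -/
theorem hubbardInteraction_mem_evenOdd_zero (β U : ℝ) : hubbardInteraction L M β U ∈ evenOdd ℂ (ι := HubbardFieldIdx L M) 0 := by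
  have h2 : ∀ (k k' : FreqMomentum L M) (σ σ' : Fin 2),
      psiPlus k σ * psiMinus k' σ' ∈ evenOdd ℂ (ι := HubbardFieldIdx L M) 0 := fun k k' σ σ' => by
    have h := SetLike.mul_mem_graded (gen_mem_evenOdd_one ℂ (((k, σ), 0) : HubbardFieldIdx L M))
      (gen_mem_evenOdd_one ℂ (((k', σ'), 1) : HubbardFieldIdx L M))
    rwa [show (1 : ZMod 2) + 1 = 0 from by decide] at h
  rw [hubbardInteraction]
  refine Submodule.smul_mem _ _ (Submodule.sum_mem _ fun k₁ _ => Submodule.sum_mem _ fun k₂ _ =>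
    Submodule.sum_mem _ fun k₃ _ => Submodule.sum_mem _ fun k₄ _ => ?_)
  split_ifs
  · rw [mul_assoc]
    exact mul_mem_evenOdd_zero ℂ (h2 k₁ k₂ 0 0) (h2 k₃ k₄ 1 1)
  · exact Submodule.zero_mem _

/-- **`𝒲[s]` is invariant under every non-zero vertex-compatible charge scaling.** -/
theorem covResp_map_scaling_effAction (φ : FreqMomentum L M × Fin 2 → ℂ) (hφ : ∀ p, φ p ≠ 0)
    (hV : ∀ k₁ k₂ k₃ k₄ : FreqMomentum L M,
      matsubaraInt M k₁.1 + matsubaraInt M k₃.1 = matsubaraInt M k₂.1 + matsubaraInt M k₄.1 ∧ k₁.2 + k₃.2 = k₂.2 + k₄.2 →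
        φ (k₁, 0) * φ (k₃, 1) = φ (k₂, 0) * φ (k₄, 1))
    (s : FreqMomentum L M × Fin 2 → ℂ) (β U : ℝ) :
    ExteriorAlgebra.map (LinearMap.mulLeft ℂ (scalingWeight φ)) (effAction ℂ (normalCovariance L M s) (hubbardInteraction L M β U)) =
      effAction ℂ (normalCovariance L M s) (hubbardInteraction L M β U) :=
  map_mulLeft_effAction_of_invariant ℂ (scalingWeightInv_mul φ hφ) (fun X Y => scalingWeight_normalCovariance_invariant φ hφ s X Y)
    (map_scaling_hubbardInteraction φ hφ hV β U)

/-- The selection rule under one compatible scaling. -/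
theorem covResp_kernel_two_eq_zero_of_weight_ne (φ : FreqMomentum L M × Fin 2 → ℂ) (hφ : ∀ p, φ p ≠ 0)
    (hV : ∀ k₁ k₂ k₃ k₄ : FreqMomentum L M,
      matsubaraInt M k₁.1 + matsubaraInt M k₃.1 = matsubaraInt M k₂.1 + matsubaraInt M k₄.1 ∧ k₁.2 + k₃.2 = k₂.2 + k₄.2 →
        φ (k₁, 0) * φ (k₃, 1) = φ (k₂, 0) * φ (k₄, 1))
    (s : FreqMomentum L M × Fin 2 → ℂ) (β U : ℝ) {X Y : HubbardFieldIdx L M} (hw : scalingWeight φ X * scalingWeight φ Y ≠ 1) :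
    kernel ℂ (effAction ℂ (normalCovariance L M s) (hubbardInteraction L M β U)) 2 ![X, Y] = 0 := by
  refine kernel_eq_zero_of_invariant ℂ (scalingWeight φ) (covResp_map_scaling_effAction φ hφ hV s β U) ?_
  simpa [Fin.prod_univ_two] using hw

/-- **Charge conservation**: the two-leg kernel of `𝒲[s]` vanishes between labels of equal charge (weight `ψ̂^± ↦ 2^{±1}ψ̂^±`). -/
theorem covResp_kernel_two_eq_zero_of_charge_eq (s : FreqMomentum L M × Fin 2 → ℂ) (β U : ℝ) (p q : FreqMomentum L M × Fin 2)
    (c : Fin 2) :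
    kernel ℂ (effAction ℂ (normalCovariance L M s) (hubbardInteraction L M β U)) 2 ![((p, c) : HubbardFieldIdx L M), (q, c)] = 0 := by
  refine covResp_kernel_two_eq_zero_of_weight_ne (fun _ => (2 : ℂ)) (fun _ => two_ne_zero) (fun _ _ _ _ _ => rfl) s β U ?_
  fin_cases c <;> norm_num [scalingWeight]

/-- A vertex-compatible non-zero weight separating `p` from `q` kills both mixed-charge two-leg kernels of `𝒲[s]` at `(p, q)`. -/
theorem covResp_kernel_two_pair_eq_zero_of_separating (φ : FreqMomentum L M × Fin 2 → ℂ) (hφ : ∀ p, φ p ≠ 0)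
    (hV : ∀ k₁ k₂ k₃ k₄ : FreqMomentum L M,
      matsubaraInt M k₁.1 + matsubaraInt M k₃.1 = matsubaraInt M k₂.1 + matsubaraInt M k₄.1 ∧ k₁.2 + k₃.2 = k₂.2 + k₄.2 →
        φ (k₁, 0) * φ (k₃, 1) = φ (k₂, 0) * φ (k₄, 1))
    (s : FreqMomentum L M × Fin 2 → ℂ) (β U : ℝ) {p q : FreqMomentum L M × Fin 2} (h : φ p ≠ φ q) :
    kernel ℂ (effAction ℂ (normalCovariance L M s) (hubbardInteraction L M β U)) 2 ![((p, 1) : HubbardFieldIdx L M), (q, 0)] = 0 ∧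
      kernel ℂ (effAction ℂ (normalCovariance L M s) (hubbardInteraction L M β U)) 2 ![((p, 0) : HubbardFieldIdx L M), (q, 1)] = 0 :=
  ⟨covResp_kernel_two_eq_zero_of_weight_ne φ hφ hV s β U (scalingWeight_pair_ne_one hφ h),
    covResp_kernel_two_eq_zero_of_weight_ne φ hφ hV s β U (scalingWeight_pair_ne_one' hφ h)⟩

/-- **Conservation of frequency, momentum and spin**: both mixed-charge two-leg kernels of `𝒲[s]` vanish between labels with
different `(frequency, momentum, spin)` (weights `2^{n(ω)}`, `χ(k⃗ᵢ)`, `2^{[σ=↑]}`, as in `…TwoPointAssemblyConservation`). -/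
theorem covResp_kernel_two_pair_eq_zero_of_ne (s : FreqMomentum L M × Fin 2 → ℂ) (β U : ℝ) {p q : FreqMomentum L M × Fin 2}
    (hpq : p ≠ q) :
    kernel ℂ (effAction ℂ (normalCovariance L M s) (hubbardInteraction L M β U)) 2 ![((p, 1) : HubbardFieldIdx L M), (q, 0)] = 0 ∧
      kernel ℂ (effAction ℂ (normalCovariance L M s) (hubbardInteraction L M β U)) 2 ![((p, 0) : HubbardFieldIdx L M), (q, 1)] = 0 := by
  obtain ⟨⟨ω, k⟩, σ⟩ := p
  obtain ⟨⟨ω', k'⟩, σ'⟩ := q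
  by_cases hω : ω = ω'
  · subst hω
    by_cases hk : k = k'
    · subst hk
      have hσ : σ ≠ σ' := fun h => hpq (by rw [h])
      refine covResp_kernel_two_pair_eq_zero_of_separating (fun p => if p.2 = 0 then 2 else 1)
        (fun p => by split_ifs <;> norm_num) (fun k₁ k₂ k₃ k₄ _ => by simp) s β U ?_
      fin_cases σ <;> fin_cases σ' <;> first | exact absurd rfl hσ | norm_num
    · obtain ⟨i, hi⟩ : ∃ i, k i ≠ k' i := Function.ne_iff.mp hk
      refine covResp_kernel_two_pair_eq_zero_of_separating (fun p => (ZMod.stdAddChar (p.1.2 i) : ℂ))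
        (fun p => stdAddChar_ne_zero _) (fun k₁ k₂ k₃ k₄ h => ?_) s β U ?_
      · rw [← AddChar.map_add_eq_mul, ← AddChar.map_add_eq_mul, ← Pi.add_apply k₁.2, ← Pi.add_apply k₂.2, h.2]
      · exact fun h => hi (ZMod.injective_stdAddChar h)
  · refine covResp_kernel_two_pair_eq_zero_of_separating (fun p => (2 : ℂ) ^ (matsubaraInt M p.1.1))
      (fun p => zpow_ne_zero _ two_ne_zero) (fun k₁ k₂ k₃ k₄ h => ?_) s β U ?_
    · rw [← zpow_add₀ two_ne_zero, ← zpow_add₀ two_ne_zero, h.1]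
    · intro h
      dsimp only at h
      apply hω
      have h2 := two_zpow_injective h
      unfold matsubaraInt at h2
      exact Fin.ext (by omega)

/-! ## §3 The tree term at the reading string is a product -/

/-- **The tree (pairing) term of the response at `X_q = (ψ̂⁺_q, ψ̂⁻_q)` is a PRODUCT**:
`kernel (δ𝒲/δψ, Ċ δ𝒲/δψ) 2 X_q = 4·ṡ(q)·𝒲₂(X_q)²` for `Ċ = normalCovariance ṡ` and `𝒲 = 𝒲[s]` (selection rules: only the pair
`A = Ā' ∈ {ψ̂^±_q}` contributes). -/
theorem covResp_kernel_two_pairing_eq (sdot s : FreqMomentum L M × Fin 2 → ℂ) (β U : ℝ) (q : FreqMomentum L M × Fin 2) :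
    kernel ℂ (grassmannDerivPairing ℂ (normalCovariance L M sdot)
        (effAction ℂ (normalCovariance L M s) (hubbardInteraction L M β U))
        (effAction ℂ (normalCovariance L M s) (hubbardInteraction L M β U))) 2 ![((q, 0) : HubbardFieldIdx L M), (q, 1)] =
      4 * sdot q * (kernel ℂ (effAction ℂ (normalCovariance L M s) (hubbardInteraction L M β U)) 2
        ![((q, 0) : HubbardFieldIdx L M), (q, 1)]) ^ 2 := by
  classical
  set W := effAction ℂ (normalCovariance L M s) (hubbardInteraction L M β U) with hW
  have hWe : W ∈ evenOdd ℂ (ι := HubbardFieldIdx L M) 0 :=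
    mem_evenPart_iff.1 (effAction_mem_evenPart _ (mem_evenPart_iff.2 (hubbardInteraction_mem_evenOdd_zero β U))
      (constPart_hubbardInteraction L M β U))
  have hcc : ∀ (p : FreqMomentum L M × Fin 2) (c : Fin 2), kernel ℂ W 2 ![((p, c) : HubbardFieldIdx L M), (q, c)] = 0 :=
    fun p c => by rw [hW]; exact covResp_kernel_two_eq_zero_of_charge_eq s β U p q c
  have hne : ∀ p : FreqMomentum L M × Fin 2, p ≠ q → kernel ℂ W 2 ![((p, 0) : HubbardFieldIdx L M), (q, 1)] = 0 :=
    fun p hp => by rw [hW]; exact (covResp_kernel_two_pair_eq_zero_of_ne s β U hp).2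
  rw [kernel_two_grassmannDerivPairing ℂ _ hWe hWe]
  simp only [Matrix.cons_val_zero, Matrix.cons_val_one]
  -- inner sum: only `B = Ā`
  have hinner : ∀ A : HubbardFieldIdx L M, ∑ B, normalCovariance L M sdot A B *
      (kernel ℂ W 2 ![A, ((q, 0) : HubbardFieldIdx L M)] * kernel ℂ W 2 ![B, ((q, 1) : HubbardFieldIdx L M)] -
        kernel ℂ W 2 ![A, ((q, 1) : HubbardFieldIdx L M)] * kernel ℂ W 2 ![B, ((q, 0) : HubbardFieldIdx L M)]) =
      normalCovariance L M sdot A (A.1, 1 - A.2) *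
        (kernel ℂ W 2 ![A, ((q, 0) : HubbardFieldIdx L M)] * kernel ℂ W 2 ![(A.1, 1 - A.2), ((q, 1) : HubbardFieldIdx L M)] -
          kernel ℂ W 2 ![A, ((q, 1) : HubbardFieldIdx L M)] * kernel ℂ W 2 ![(A.1, 1 - A.2), ((q, 0) : HubbardFieldIdx L M)]) :=
    fun A => Finset.sum_eq_single (A.1, 1 - A.2) (fun B _ hB => by rw [normalCovariance_eq_zero_of_ne_bar sdot A B hB, zero_mul])
      (fun h => absurd (mem_univ _) h)
  simp_rw [hinner]
  -- split `A = (p, c)` and use the selection rules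
  rw [Fintype.sum_prod_type]
  have hterm : ∀ p : FreqMomentum L M × Fin 2, ∑ c : Fin 2, normalCovariance L M sdot (p, c) (p, 1 - c) *
      (kernel ℂ W 2 ![((p, c) : HubbardFieldIdx L M), (q, 0)] * kernel ℂ W 2 ![((p, 1 - c) : HubbardFieldIdx L M), (q, 1)] -
        kernel ℂ W 2 ![((p, c) : HubbardFieldIdx L M), (q, 1)] * kernel ℂ W 2 ![((p, 1 - c) : HubbardFieldIdx L M), (q, 0)]) =
      -2 * sdot p * (kernel ℂ W 2 ![((p, 0) : HubbardFieldIdx L M), (q, 1)] * kernel ℂ W 2 ![((p, 1) : HubbardFieldIdx L M), (q, 0)]) := by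
    intro p
    rw [Fin.sum_univ_two]
    simp only [Fin.isValue, sub_zero, sub_self, (normalCovariance_bar sdot p).1, (normalCovariance_bar sdot p).2, hcc p 0, hcc p 1]
    ring
  simp_rw [hterm]
  rw [Finset.sum_eq_single q (fun p _ hp => by rw [hne p hp, zero_mul, mul_zero]) (fun h => absurd (mem_univ _) h),
    KLRegimeWick.kernel_two_swap01 W ((q, 0) : HubbardFieldIdx L M) ((q, 1) : HubbardFieldIdx L M)]
  ring

/-! ## §4 The loop term at the reading string -/

/-- **The loop term of the response**: `‖kernel (Δ_Ċ 𝒲) 2 X‖ ≤ 12·(Σ_p ‖ṡ p‖)·N` whenever `‖𝒲₄(X, Ā, A)‖ ≤ N` for all `A`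
(`Ċ = normalCovariance ṡ`: entry sum `2Σ|ṡ|`; `6` pair positions). -/
theorem covResp_norm_kernel_two_laplacian_le (sdot : FreqMomentum L M × Fin 2 → ℂ) (W : HubbardGrassmann L M)
    (X : Fin 2 → HubbardFieldIdx L M) {N : ℝ}
    (hN : ∀ A : HubbardFieldIdx L M, ‖kernel ℂ W 4 (Fin.snoc (Fin.snoc X (A.1, 1 - A.2) : Fin 3 → HubbardFieldIdx L M) A)‖ ≤ N) :
    ‖kernel ℂ (grassmannLaplacian ℂ (normalCovariance L M sdot) W) 2 X‖ ≤ 12 * (∑ p, ‖sdot p‖) * N := by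
  have h := norm_kernel_two_grassmannLaplacian_le_of_pairing (normalCovariance L M sdot) (fun A => (A.1, 1 - A.2))
    (fun A B hB => normalCovariance_eq_zero_of_ne_bar sdot A B hB) W X hN
  have hs : ∑ A : HubbardFieldIdx L M, ‖normalCovariance L M sdot A ((fun A : HubbardFieldIdx L M => (A.1, 1 - A.2)) A)‖ =
      2 * ∑ p, ‖sdot p‖ := sum_norm_normalCovariance_bar sdot
  rw [hs] at h
  calc _ ≤ 6 * (2 * ∑ p, ‖sdot p‖) * N := h
    _ = 12 * (∑ p, ‖sdot p‖) * N := by ring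

/-! ## §5 The response inequality -/

/-- **THE COVARIANCE RESPONSE OF THE TWO-LEG KERNEL AT THE READING STRING** (Polchinski interpolation, mean-value form).
`𝒲_t := effAction (C₀ + t(C₁ − C₀)) V_U`, `C_i = normalCovariance s_i`; if on `t ∈ [0,1]` the partition function does not vanish,
the four-leg kernels at `(X_q, Ā, A)` are `≤ N` and the two-leg kernel at `X_q` is `≤ S`, then
`‖𝒲[s₁]₂(X_q) − 𝒲[s₀]₂(X_q)‖ ≤ 12·(Σ_p ‖(s₁−s₀) p‖)·N + 2·‖(s₁−s₀) q‖·S²`. -/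
theorem covResp_norm_kernel_two_sub_le (s₀ s₁ : FreqMomentum L M × Fin 2 → ℂ) (β U : ℝ) (q : FreqMomentum L M × Fin 2)
    (hZ : ∀ t ∈ Set.Icc (0 : ℝ) 1, effPartitionFn ℂ (normalCovariance L M s₀ + ((t : ℂ)) • (normalCovariance L M s₁ - normalCovariance L M s₀))
      (hubbardInteraction L M β U) ≠ 0)
    {N S : ℝ}
    (hN : ∀ t ∈ Set.Icc (0 : ℝ) 1, ∀ A : HubbardFieldIdx L M,
      ‖kernel ℂ (effAction ℂ (normalCovariance L M s₀ + ((t : ℂ)) • (normalCovariance L M s₁ - normalCovariance L M s₀))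
        (hubbardInteraction L M β U)) 4
        (Fin.snoc (Fin.snoc ![((q, 0) : HubbardFieldIdx L M), (q, 1)] (A.1, 1 - A.2) : Fin 3 → HubbardFieldIdx L M) A)‖ ≤ N)
    (hS : ∀ t ∈ Set.Icc (0 : ℝ) 1,
      ‖kernel ℂ (effAction ℂ (normalCovariance L M s₀ + ((t : ℂ)) • (normalCovariance L M s₁ - normalCovariance L M s₀))
        (hubbardInteraction L M β U)) 2 ![((q, 0) : HubbardFieldIdx L M), (q, 1)]‖ ≤ S) :
    ‖kernel ℂ (effAction ℂ (normalCovariance L M s₁) (hubbardInteraction L M β U)) 2 ![((q, 0) : HubbardFieldIdx L M), (q, 1)] -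
        kernel ℂ (effAction ℂ (normalCovariance L M s₀) (hubbardInteraction L M β U)) 2 ![((q, 0) : HubbardFieldIdx L M), (q, 1)]‖ ≤
      12 * (∑ p, ‖s₁ p - s₀ p‖) * N + 2 * ‖s₁ q - s₀ q‖ * S ^ 2 := by
  classical
  letI : LinearOrder (HubbardFieldIdx L M) := LinearOrder.lift' (Fintype.equivFin _) (Fintype.equivFin _).injective
  set X : Fin 2 → HubbardFieldIdx L M := ![((q, 0) : HubbardFieldIdx L M), (q, 1)] with hX
  -- the two-leg kernel at `X` as a linear functional
  let Φ : HubbardGrassmann L M →ₗ[ℂ] ℂ :=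
    { toFun := fun F => kernel ℂ F 2 X
      map_add' := fun F G => kernel_add ℂ F G 2 X
      map_smul' := fun c F => by rw [kernel_smul, RingHom.id_apply, smul_eq_mul] }
  have hΦ1 : Φ 1 = 0 := by
    show kernel ℂ (1 : HubbardGrassmann L M) 2 X = 0
    rw [kernel_def, iterDeriv_succ_apply, grassmannDeriv_one, map_zero, map_zero, mul_zero]
  have hV0 := constPart_hubbardInteraction L M β U
  have hVe : hubbardInteraction L M β U ∈ evenOdd ℂ (ι := HubbardFieldIdx L M) 0 := hubbardInteraction_mem_evenOdd_zero β U
  refine norm_apply_effAction_sub_le_of_linePath (normalCovariance L M s₀) (normalCovariance L M s₁) hV0 hVe hZ Φ hΦ1 ?_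
  intro t ht
  -- along the path the covariance is normal with symbol `s_t`, and `Ċ` is normal with symbol `s₁ − s₀`
  have hNt := hN t ht
  have hSt0 := hS t ht
  rw [normalCovariance_linePath, normalCovariance_sub]
  rw [normalCovariance_linePath] at hNt hSt0
  set st : FreqMomentum L M × Fin 2 → ℂ := fun p => s₀ p + (t : ℂ) * (s₁ p - s₀ p) with hst
  set W := effAction ℂ (normalCovariance L M st) (hubbardInteraction L M β U) with hW
  have hloop : ‖Φ (grassmannLaplacian ℂ (normalCovariance L M fun p => s₁ p - s₀ p) W)‖ ≤ 12 * (∑ p, ‖s₁ p - s₀ p‖) * N :=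
    covResp_norm_kernel_two_laplacian_le (fun p => s₁ p - s₀ p) W X hNt
  have htree : Φ (grassmannDerivPairing ℂ (normalCovariance L M fun p => s₁ p - s₀ p) W W) =
      4 * (s₁ q - s₀ q) * (kernel ℂ W 2 X) ^ 2 :=
    covResp_kernel_two_pairing_eq (fun p => s₁ p - s₀ p) st β U q
  have hSt : ‖kernel ℂ W 2 X‖ ≤ S := hSt0
  have hS0 : 0 ≤ S := (norm_nonneg _).trans hSt
  calc ‖Φ (grassmannLaplacian ℂ (normalCovariance L M fun p => s₁ p - s₀ p) W) -
        (2 : ℂ)⁻¹ * Φ (grassmannDerivPairing ℂ (normalCovariance L M fun p => s₁ p - s₀ p) W W)‖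
      ≤ ‖Φ (grassmannLaplacian ℂ (normalCovariance L M fun p => s₁ p - s₀ p) W)‖ +
          ‖(2 : ℂ)⁻¹ * Φ (grassmannDerivPairing ℂ (normalCovariance L M fun p => s₁ p - s₀ p) W W)‖ := norm_sub_le _ _
    _ ≤ 12 * (∑ p, ‖s₁ p - s₀ p‖) * N + 2 * ‖s₁ q - s₀ q‖ * S ^ 2 := by
      refine add_le_add hloop ?_
      rw [htree, norm_mul, norm_mul, norm_mul, norm_pow, norm_inv, RCLike.norm_ofNat, RCLike.norm_ofNat]
      have : ‖kernel ℂ W 2 X‖ ^ 2 ≤ S ^ 2 := pow_le_pow_left₀ (norm_nonneg _) hSt 2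
      nlinarith [norm_nonneg (s₁ q - s₀ q)]

/-- **The same in the `selfEnergy` normalisation** (`selfEnergy = vertexFn₂ = 2·βL²·kernel₂` at the string `(ψ̂⁺_{kσ}, ψ̂⁻_{kσ})`):
`‖Σ[s₁](k,σ) − Σ[s₀](k,σ)‖ ≤ 2|β|L²·(12·(Σ_p ‖(s₁−s₀) p‖)·N + 2·‖(s₁−s₀)(k,σ)‖·S²)`. -/
theorem covResp_norm_selfEnergy_sub_le (s₀ s₁ : FreqMomentum L M × Fin 2 → ℂ) (β U : ℝ) (k : FreqMomentum L M) (σ : Fin 2)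
    (hZ : ∀ t ∈ Set.Icc (0 : ℝ) 1, effPartitionFn ℂ (normalCovariance L M s₀ + ((t : ℂ)) • (normalCovariance L M s₁ - normalCovariance L M s₀))
      (hubbardInteraction L M β U) ≠ 0)
    {N S : ℝ}
    (hN : ∀ t ∈ Set.Icc (0 : ℝ) 1, ∀ A : HubbardFieldIdx L M,
      ‖kernel ℂ (effAction ℂ (normalCovariance L M s₀ + ((t : ℂ)) • (normalCovariance L M s₁ - normalCovariance L M s₀))
        (hubbardInteraction L M β U)) 4
        (Fin.snoc (Fin.snoc ![(((k, σ), 0) : HubbardFieldIdx L M), ((k, σ), 1)] ((A.1, 1 - A.2)) : Fin 3 → HubbardFieldIdx L M) A)‖ ≤ N)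
    (hS : ∀ t ∈ Set.Icc (0 : ℝ) 1,
      ‖kernel ℂ (effAction ℂ (normalCovariance L M s₀ + ((t : ℂ)) • (normalCovariance L M s₁ - normalCovariance L M s₀))
        (hubbardInteraction L M β U)) 2 ![(((k, σ), 0) : HubbardFieldIdx L M), ((k, σ), 1)]‖ ≤ S) :
    ‖selfEnergy L M β (effAction ℂ (normalCovariance L M s₁) (hubbardInteraction L M β U)) k σ -
        selfEnergy L M β (effAction ℂ (normalCovariance L M s₀) (hubbardInteraction L M β U)) k σ‖ ≤
      2 * (|β| * (L : ℝ) ^ 2) * (12 * (∑ p, ‖s₁ p - s₀ p‖) * N + 2 * ‖s₁ (k, σ) - s₀ (k, σ)‖ * S ^ 2) := by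
  have h := covResp_norm_kernel_two_sub_le s₀ s₁ β U (k, σ) hZ hN hS
  rw [selfEnergy, selfEnergy, vertexFn_def, vertexFn_def, ← mul_sub, norm_mul]
  have hc : ‖((((2 : ℕ).factorial : ℝ) * (β * (L : ℝ) ^ 2) ^ (2 - 1) : ℝ) : ℂ)‖ = 2 * (|β| * (L : ℝ) ^ 2) := by
    rw [Complex.norm_real, Real.norm_eq_abs, Nat.factorial_two]
    simp [abs_mul, abs_pow]
  rw [hc]
  exact mul_le_mul_of_nonneg_left h (by positivity)

end Summit.HubbardSuperconductivity.HubbardSuperconductivity.Theorems.EngineV8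

end
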